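import Mathlib
import Summits.ABC.Statement
import Literature.NumberTheory.DiophantineGeometry.AbcWave0

/-!
# In-place glue for a restated crux #2 of route `IneffectiveSubspace` (line `flat-steep-split`, lead c2)

PURPOSE.  A Theses file cannot import `Summits/…/Theorems/*` (they import it), so the route's deciding theorem
`closes` must be proved IN PLACE.  If the planner restates crux #2 `UniformSadicTowerFour` (stmt-ABC-14937) as its
heavy child HEAVY-CORE (c1's `HeavyPlacesFour`) — or as BoundedOmegaABC — this file is the paste-ready proof term:
it imports EXACTLY what `Summits/ABC/ABC/Theses/IneffectiveSubspace.lean` imports (`Mathlib`, `Summits.ABC.Statement`,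
`Literature.NumberTheory.DiophantineGeometry.AbcWave0`), declares no `def`, and proves

* `abc_of_heavyCore_of_deepRegime : HEAVY-CORE → DeepRegimeABC-statement → ABC`   (option 2 of the c2 report),
* `abc_of_boundedOmega_of_deepRegime : BoundedOmegaABC → DeepRegimeABC-statement → ABC` (option 3),
* `abc_of_boundedOmega_of_omegaTail : BoundedOmegaABC → OmegaTailABC → ABC` (option 3 with #6 in ω-normal form;
  a 15-line case split),

with every hypothesis SPELLED OUT (no Theses names), inside the paste-safe sub-namespace `ClosesGlueC2`.
The mathematics is a verbatim port of the landed Theorems files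
`IneffectiveSubspaceUniformSadicTowerFourHeavyGivesBoundedOmega.lean` (p139963: HEAVY-CORE ⟹ BoundedOmegaABC),
`IneffectiveSubspaceUniformSadicTowerFourFlatSteepSplit.lean` (p137179: `real_step`, `light_prod_le`, `rounded_le_full`),
`IneffectiveSubspaceUniformSadicTowerFourQuarticRootWall.lean` (rpow bookkeeping) and
`IneffectiveSubspaceDeepRegimeABCOmegaTail.lean` (quintic breeding: `DeepRegimeABC ⟹` abc on `{ω(abc) ≥ W(ε)}`, and the
complement theorem).  To paste: drop the three `import` lines and the module docstring, keep the rest inside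
`namespace Summit.ABC.ABC.Theses.IneffectiveSubspace … end` (the sub-namespace nests), and write
`closes (h₂ : HeavyPlacesFour) (_h₃) (_h₄) (h₆ : DeepRegimeABC) : ABC := ClosesGlueC2.abc_of_heavyCore_of_deepRegime h₂ h₆`.
-/

noncomputable section

-- `Summit.<Summit>.<Problem>` is the mandated summit-side namespace (CONVENTIONS §2); for the
-- single-conjunct summit `ABC` the two coincide, so the duplicate `ABC.ABC` is deliberate.
set_option linter.dupNamespace false

namespace Summit.ABC.ABC.Theses.IneffectiveSubspace.ClosesGlueC2

open Literature.NumberTheory.DiophantineGeometry (IsABCTriple rad rad_def)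
open scoped BigOperators

/-! ## §1 Real-exponent bookkeeping (ported from `QuarticRootWall`, `FlatSteepSplit`) -/

/-- If `X^a < K·Y^b` with `X, K, Y ≥ 0` and `a > 0` then `X < K^(1/a)·Y^(b/a)`. [folklore] -/
theorem lt_rpow_mul_rpow_of_rpow_lt {X K Y a b : ℝ} (hX : 0 ≤ X) (hK : 0 ≤ K) (hY : 0 ≤ Y)
    (ha : 0 < a) (h : X ^ a < K * Y ^ b) : X < K ^ (1 / a) * Y ^ (b / a) := by
  have h1 : (X ^ a) ^ (1 / a) < (K * Y ^ b) ^ (1 / a) :=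
    Real.rpow_lt_rpow (by positivity) h (by positivity)
  rw [← Real.rpow_mul hX, mul_one_div_cancel ha.ne', Real.rpow_one,
    Real.mul_rpow hK (by positivity), ← Real.rpow_mul hY, mul_one_div] at h1
  exact h1

/-- For `1 ≤ K`, `1 ≤ Y`, exponents `p ≤ p'` and `q ≤ q'`: `K^p·Y^q ≤ K^p'·Y^q'`. [folklore] -/
theorem rpow_mul_rpow_le {K Y p p' q q' : ℝ} (hK : 1 ≤ K) (hY : 1 ≤ Y) (hp : p ≤ p') (hq : q ≤ q') :
    K ^ p * Y ^ q ≤ K ^ p' * Y ^ q' :=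
  mul_le_mul (Real.rpow_le_rpow_of_exponent_le hK hp) (Real.rpow_le_rpow_of_exponent_le hY hq)
    (by positivity) (by positivity)

/-- If `c < C · X^s`, `X ≤ M · c^d` with `C, M, c ≥ 1`, `X ≥ 0`, `s > 0`, `d·s ≤ 1/2` and
`s ≤ t·(1 − d·s)`, then `c < C² · M^t`. [folklore] -/
theorem real_step {C s d t c M X : ℝ} (hC : 1 ≤ C) (hs : 0 < s)
    (hds : d * s ≤ 1 / 2) (hst : s ≤ t * (1 - d * s)) (hc : 1 ≤ c) (hM : 1 ≤ M) (hX0 : 0 ≤ X)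
    (hX : X ≤ M * c ^ d) (h : c < C * X ^ s) : c < C ^ (2 : ℝ) * M ^ t := by
  have hc0 : 0 < c := by linarith
  have hM0 : 0 ≤ M := by linarith
  have hC0 : 0 ≤ C := by linarith
  have h1 : c < C * M ^ s * c ^ (d * s) := by
    have hXs : X ^ s ≤ (M * c ^ d) ^ s := Real.rpow_le_rpow hX0 hX hs.le
    have : (M * c ^ d) ^ s = M ^ s * c ^ (d * s) := by
      rw [Real.mul_rpow hM0 (Real.rpow_nonneg hc0.le d), ← Real.rpow_mul hc0.le]
    calc c < C * X ^ s := h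
      _ ≤ C * (M * c ^ d) ^ s := mul_le_mul_of_nonneg_left hXs hC0
      _ = C * M ^ s * c ^ (d * s) := by rw [this, mul_assoc]
  have hγ : 0 < 1 - d * s := by linarith
  have h2 : c ^ (1 - d * s) < C * M ^ s := by
    rw [Real.rpow_sub hc0, Real.rpow_one, div_lt_iff₀ (Real.rpow_pos_of_pos hc0 _)]
    exact h1
  have h3 := lt_rpow_mul_rpow_of_rpow_lt hc0.le hC0 hM0 hγ h2
  refine h3.trans_le (rpow_mul_rpow_le hC hM ?_ ?_)
  · rw [div_le_iff₀ hγ]; linarith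
  · rw [div_le_iff₀ hγ]; linarith

/-! ## §2 Blocks of an abc triple (ported from `FlatSteepSplit`, `HeavyGivesBoundedOmega`) -/

/-- Rounding only lowers a charge: on a set of prime factors of `N`, `∏ p^⌈v_p/4⌉ ≤ ∏ p^{v_p}`. [folklore] -/
theorem rounded_le_full (N : ℕ) {A : Finset ℕ} (hA : A ⊆ N.primeFactors) :
    ∏ p ∈ A, p ^ ((N.factorization p + 3) / 4) ≤ ∏ p ∈ A, p ^ N.factorization p := by
  refine Finset.prod_le_prod' fun p hp => ?_
  have hpN := Nat.mem_primeFactors.mp (hA hp)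
  have hv : 0 < N.factorization p := hpN.1.factorization_pos_of_dvd hpN.2.2 hpN.2.1
  exact Nat.pow_le_pow_right hpN.1.pos (by omega)

/-- At most `K` light blocks cost less than `(c^θ)^K`. [folklore] -/
theorem light_prod_le {N c K : ℕ} {θ : ℝ} {A : Finset ℕ} (hc : 1 ≤ c) (hθ : 0 ≤ θ)
    (hcard : A.card ≤ K)
    (hlight : ∀ q ∈ A, ((q ^ N.factorization q : ℕ) : ℝ) < (c : ℝ) ^ θ) :
    ((∏ q ∈ A, q ^ N.factorization q : ℕ) : ℝ) ≤ ((c : ℝ) ^ θ) ^ K := by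
  have hc1 : (1 : ℝ) ≤ c := by exact_mod_cast hc
  have h1 : (1 : ℝ) ≤ (c : ℝ) ^ θ := Real.one_le_rpow hc1 hθ
  calc ((∏ q ∈ A, q ^ N.factorization q : ℕ) : ℝ)
      = ∏ q ∈ A, ((q ^ N.factorization q : ℕ) : ℝ) := by push_cast; rfl
    _ ≤ ∏ _q ∈ A, (c : ℝ) ^ θ :=
        Finset.prod_le_prod (fun q _ => by positivity) fun q hq => (hlight q hq).le
    _ = ((c : ℝ) ^ θ) ^ A.card := Finset.prod_const _
    _ ≤ ((c : ℝ) ^ θ) ^ K := pow_le_pow_right₀ h1 hcard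

/-- If `ω(abc) ≤ W` and `θ·W ≤ 1/2` (`θ ≥ 0`), some prime `p ∣ abc` is θ-heavy, `c^θ ≤ p^{v_p(abc)}`:
otherwise `abc = ∏ p^{v_p} < (c^θ)^W ≤ c^{1/2} < c ≤ abc`. [folklore] -/
theorem exists_heavy_block {a b c : ℕ} (h : IsABCTriple a b c) {θ : ℝ} (hθ : 0 ≤ θ) {W : ℕ}
    (hθW : θ * W ≤ 1 / 2) (hcard : (a * b * c).primeFactors.card ≤ W) :
    ∃ p ∈ (a * b * c).primeFactors,
      (c : ℝ) ^ θ ≤ ((p ^ (a * b * c).factorization p : ℕ) : ℝ) := by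
  obtain ⟨ha, hb, hsum, _⟩ := h
  set N := a * b * c with hNdef
  have hc2 : 2 ≤ c := by omega
  have hc1 : 1 ≤ c := by omega
  have hN0 : N ≠ 0 := by positivity
  by_contra hall
  push Not at hall
  have hprod : ∏ p ∈ N.primeFactors, p ^ N.factorization p = N :=
    (Nat.prod_primeFactors_pow_factorization hN0).symm
  have h1 : (N : ℝ) ≤ ((c : ℝ) ^ θ) ^ W := by
    have := light_prod_le (N := N) hc1 hθ hcard hall
    rwa [hprod] at this
  have hc0 : (0 : ℝ) ≤ c := by positivity
  have hc1R : (1 : ℝ) < c := by exact_mod_cast hc2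
  have h2 : ((c : ℝ) ^ θ) ^ W ≤ (c : ℝ) ^ (1 / 2 : ℝ) := by
    rw [← Real.rpow_natCast, ← Real.rpow_mul hc0]
    exact Real.rpow_le_rpow_of_exponent_le hc1R.le hθW
  have h3 : (c : ℝ) ^ (1 / 2 : ℝ) < c := by
    conv_rhs => rw [← Real.rpow_one (c : ℝ)]
    exact Real.rpow_lt_rpow_of_exponent_lt hc1R (by norm_num)
  have h4 : (c : ℝ) ≤ N := by
    exact_mod_cast (Nat.le_mul_of_pos_left c (Nat.mul_pos ha hb) : c ≤ a * b * c)
  linarith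

/-! ## §3 HEAVY-CORE ⟹ BoundedOmegaABC (ported from `HeavyGivesBoundedOmega`, p139963) -/

/-- **HEAVY-CORE ⟹ abc on every bounded-`ω` cell.** [folklore] -/
theorem boundedOmega_of_heavyCore
    (h : ∀ θ : ℝ, 0 < θ → θ ≤ 1 → ∀ ε : ℝ, 0 < ε → ∃ C : ℝ, 0 < C ∧ ∀ S : Finset ℕ, S.Nonempty →
      (∀ p ∈ S, Nat.Prime p) → ∀ a b c : ℕ, IsABCTriple a b c →
      (∀ p ∈ S, (c : ℝ) ^ θ ≤ ((p ^ (a * b * c).factorization p : ℕ) : ℝ)) →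
      (c : ℝ) < C * ((((∏ p ∈ S, p) *
        ∏ p ∈ (a * b * c).primeFactors \ S, p ^ (((a * b * c).factorization p + 3) / 4) : ℕ) : ℝ)) ^
          (1 + ε)) :
    ∀ W : ℕ, ∀ ε : ℝ, 0 < ε → ∃ C : ℝ, 0 < C ∧ ∀ a b c : ℕ, IsABCTriple a b c →
      (a * b * c).primeFactors.card ≤ W →
      (c : ℝ) < C * ((rad a b c : ℕ) : ℝ) ^ (1 + ε) := by
  classical
  intro W ε₀ hε₀
  set ε₁ : ℝ := ε₀ / 2 with hε₁def
  have hε₁ : 0 < ε₁ := by positivity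
  set D : ℝ := ((W : ℝ) + 1) * ((1 + ε₀) * (2 + ε₀)) with hDdef
  have hD : 0 < D := by positivity
  set θ₀ : ℝ := ε₀ / D with hθ₀def
  have hθ₀ : 0 < θ₀ := by positivity
  have hθ₀D : θ₀ * D = ε₀ := div_mul_cancel₀ ε₀ hD.ne'
  set θ : ℝ := min θ₀ (1 / 4) with hθdef
  have hθ : 0 < θ := lt_min hθ₀ (by norm_num)
  have hθle : θ ≤ θ₀ := min_le_left _ _
  have hθ1 : θ ≤ 1 := (min_le_right _ _).trans (by norm_num)
  have hθW : θ * W * ((1 + ε₀) * (2 + ε₀)) ≤ ε₀ := by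
    have hW1 : (W : ℝ) ≤ W + 1 := by linarith
    calc θ * W * ((1 + ε₀) * (2 + ε₀)) ≤ θ₀ * (W + 1) * ((1 + ε₀) * (2 + ε₀)) := by
          gcongr
      _ = θ₀ * D := by rw [hDdef]; ring
      _ = ε₀ := hθ₀D
  obtain ⟨C₂, hC₂, hheavy⟩ := h θ hθ hθ1 ε₁ hε₁
  set C₀ : ℝ := max C₂ 1 with hC₀def
  have hC₀1 : 1 ≤ C₀ := le_max_right _ _
  have hC₂le : C₂ ≤ C₀ := le_max_left _ _
  refine ⟨C₀ ^ (2 : ℝ), by positivity, fun a b c habc hcardW => ?_⟩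
  have habc' := habc
  obtain ⟨ha, hb, hsum, hcop⟩ := habc
  set N := a * b * c with hNdef
  have hc1 : 1 ≤ c := by omega
  have hc1R : (1 : ℝ) ≤ c := by exact_mod_cast hc1
  have hN0 : N ≠ 0 := by positivity
  have hs : (0 : ℝ) < 1 + ε₁ := by linarith
  have hd : (0 : ℝ) ≤ θ * W := by positivity
  have hds : θ * W * (1 + ε₁) ≤ 1 / 2 := by
    rw [hε₁def]; nlinarith [hθW, hε₀, hd, mul_nonneg hd hε₀.le]
  have hst : 1 + ε₁ ≤ (1 + ε₀) * (1 - θ * W * (1 + ε₁)) := by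
    rw [hε₁def]; nlinarith [hθW, hε₀, hd]
  have hθWhalf : θ * W ≤ 1 / 2 := by nlinarith [hds, mul_nonneg hd hε₁.le]
  set H := N.primeFactors.filter (fun q => (c : ℝ) ^ θ ≤ ((q ^ N.factorization q : ℕ) : ℝ))
    with hHdef
  have hHsub : H ⊆ N.primeFactors := Finset.filter_subset _ _
  have hHprime : ∀ p ∈ H, p.Prime := fun p hp => Nat.prime_of_mem_primeFactors (hHsub hp)
  have hHheavy : ∀ p ∈ H, (c : ℝ) ^ θ ≤ ((p ^ N.factorization p : ℕ) : ℝ) := fun p hp =>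
    (Finset.mem_filter.mp hp).2
  have hlight : ∀ q ∈ N.primeFactors \ H, ((q ^ N.factorization q : ℕ) : ℝ) < (c : ℝ) ^ θ := by
    intro q hq
    rw [Finset.mem_sdiff] at hq
    by_contra hle
    exact hq.2 (Finset.mem_filter.mpr ⟨hq.1, not_lt.mp hle⟩)
  have hHne : H.Nonempty := by
    obtain ⟨p, hp, hpH⟩ := exists_heavy_block habc' hθ.le hθWhalf hcardW
    exact ⟨p, Finset.mem_filter.mpr ⟨hp, hpH⟩⟩
  have key := hheavy H hHne hHprime a b c habc' hHheavy
  have hcθW : ((c : ℝ) ^ θ) ^ W = (c : ℝ) ^ (θ * W) := by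
    rw [← Real.rpow_natCast, ← Real.rpow_mul (by positivity : (0 : ℝ) ≤ c)]
  have hradpos : 0 < rad a b c := by
    rw [rad_def]; exact Nat.pos_of_ne_zero UniqueFactorizationMonoid.radical_ne_zero
  have hM1 : (1 : ℝ) ≤ (rad a b c : ℕ) := by exact_mod_cast hradpos
  have hHrad : ∏ p ∈ H, p ≤ rad a b c := by
    rw [rad_def, Nat.radical_eq_prod_primeFactors]
    exact Nat.le_of_dvd (Finset.prod_pos fun p hp => Nat.pos_of_mem_primeFactors hp)
      (Finset.prod_dvd_prod_of_subset _ _ _ hHsub)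
  have hcardA : (N.primeFactors \ H).card ≤ W :=
    (Finset.card_le_card Finset.sdiff_subset).trans hcardW
  have hXR : ((((∏ p ∈ H, p) * ∏ p ∈ N.primeFactors \ H, p ^ ((N.factorization p + 3) / 4) : ℕ) : ℝ))
      ≤ ((rad a b c : ℕ) : ℝ) * (c : ℝ) ^ (θ * W) := by
    have h1 : (∏ p ∈ H, p) * ∏ p ∈ N.primeFactors \ H, p ^ ((N.factorization p + 3) / 4) ≤
        rad a b c * ∏ p ∈ N.primeFactors \ H, p ^ N.factorization p :=
      Nat.mul_le_mul hHrad (rounded_le_full N Finset.sdiff_subset)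
    have h2 : ((((∏ p ∈ H, p) * ∏ p ∈ N.primeFactors \ H, p ^ ((N.factorization p + 3) / 4) : ℕ) : ℝ))
        ≤ ((rad a b c : ℕ) : ℝ) * ((∏ p ∈ N.primeFactors \ H, p ^ N.factorization p : ℕ) : ℝ) := by
      exact_mod_cast h1
    refine h2.trans (mul_le_mul_of_nonneg_left ?_ (by positivity))
    rw [← hcθW]
    exact light_prod_le hc1 hθ.le hcardA hlight
  have key' : (c : ℝ) < C₀ * ((((∏ p ∈ H, p) *
      ∏ p ∈ N.primeFactors \ H, p ^ ((N.factorization p + 3) / 4) : ℕ) : ℝ)) ^ (1 + ε₁) :=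
    key.trans_le (mul_le_mul_of_nonneg_right hC₂le (by positivity))
  exact real_step hC₀1 hs hds hst hc1R hM1 (Nat.cast_nonneg _) hXR key'

/-! ## §4 Quintic breeding: the deep tail gives the many-primes tail (ported from `DeepRegimeABC.OmegaTail`) -/

/-- abc triples are symmetric in `a, b`. [folklore] -/
theorem isABCTriple_swap {a b c : ℕ} (h : IsABCTriple a b c) : IsABCTriple b a c :=
  ⟨h.2.1, h.1, by rw [Nat.add_comm]; exact h.2.2.1, h.2.2.2.symm⟩

/-- The radical glue is symmetric in `a, b`. [folklore] -/
theorem rad_swap (a b c : ℕ) : rad b a c = rad a b c := by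
  rw [rad_def, rad_def, mul_comm b a]

/-- `c⁵ − b⁵ = a · Φ₅(c,b)` when `a + b = c`. [folklore] -/
theorem pow_five_sub_pow_five_eq {a b c : ℕ} (h : a + b = c) :
    c ^ 5 - b ^ 5 = a * (c ^ 4 + c ^ 3 * b + c ^ 2 * b ^ 2 + c * b ^ 3 + b ^ 4) := by
  subst h
  apply Nat.sub_eq_of_eq_add
  ring

/-- `Φ₅(c,b) ≤ 5c⁴` for `b ≤ c`. [folklore] -/
theorem quinticCofactor_le {b c : ℕ} (hbc : b ≤ c) :
    c ^ 4 + c ^ 3 * b + c ^ 2 * b ^ 2 + c * b ^ 3 + b ^ 4 ≤ 5 * c ^ 4 := by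
  have h1 : c ^ 3 * b ≤ c ^ 3 * c := Nat.mul_le_mul_left _ hbc
  have h2 : c ^ 2 * b ^ 2 ≤ c ^ 2 * c ^ 2 := Nat.mul_le_mul_left _ (Nat.pow_le_pow_left hbc 2)
  have h3 : c * b ^ 3 ≤ c * c ^ 3 := Nat.mul_le_mul_left _ (Nat.pow_le_pow_left hbc 3)
  have h4 : b ^ 4 ≤ c ^ 4 := Nat.pow_le_pow_left hbc 4
  have e1 : c ^ 3 * c = c ^ 4 := (by ring); have e2 : c ^ 2 * c ^ 2 = c ^ 4 := by ring
  have e3 : c * c ^ 3 = c ^ 4 := by ring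
  omega

/-- `0 < Φ₅(c,b)` for `0 < c`. [folklore] -/
theorem quinticCofactor_pos {b c : ℕ} (hc : 0 < c) :
    0 < c ^ 4 + c ^ 3 * b + c ^ 2 * b ^ 2 + c * b ^ 3 + b ^ 4 := by
  have : 0 < c ^ 4 := pow_pos hc 4
  omega

/-- Breeding preserves abc triples: `(c⁵ − b⁵) + b⁵ = c⁵`. [folklore] -/
theorem isABCTriple_quinticBreed {a b c : ℕ} (h : IsABCTriple a b c) :
    IsABCTriple (c ^ 5 - b ^ 5) (b ^ 5) (c ^ 5) := by
  obtain ⟨ha, hb, habc, hcop⟩ := h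
  have hbc : b < c := by omega
  have hpow : b ^ 5 < c ^ 5 := Nat.pow_lt_pow_left hbc (by norm_num)
  have hcb : Nat.Coprime c b := by
    rw [← habc]; exact Nat.coprime_add_self_left.mpr hcop
  refine ⟨Nat.sub_pos_of_lt hpow, pow_pos hb 5, Nat.sub_add_cancel hpow.le, ?_⟩
  exact (Nat.coprime_sub_self_left hpow.le).mpr (Nat.Coprime.pow 5 5 hcb)

/-- A product over a union is at most the product of the two products (positive entries). [folklore] -/
theorem prod_union_le_prod_mul_prod {s t : Finset ℕ} (h : ∀ p ∈ s ∩ t, 0 < p) :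
    (∏ p ∈ s ∪ t, p) ≤ (∏ p ∈ s, p) * ∏ p ∈ t, p := by
  rw [← Finset.prod_union_inter]
  exact Nat.le_mul_of_pos_right _ (Finset.prod_pos h)

/-- **Breeding, radical**: `rad((c⁵−b⁵)·b⁵·c⁵) ≤ rad(abc)·5c⁴`. [folklore] -/
theorem rad_quinticBreed_le {a b c : ℕ} (h : IsABCTriple a b c) :
    rad (c ^ 5 - b ^ 5) (b ^ 5) (c ^ 5) ≤ rad a b c * (5 * c ^ 4) := by
  obtain ⟨ha, hb, habc, hcop⟩ := h
  have hc : 0 < c := (by omega); have hbc : b ≤ c := by omega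
  set Φ : ℕ := c ^ 4 + c ^ 3 * b + c ^ 2 * b ^ 2 + c * b ^ 3 + b ^ 4 with hΦdef
  have hΦ : 0 < Φ := quinticCofactor_pos hc
  have hx : c ^ 5 - b ^ 5 = a * Φ := pow_five_sub_pow_five_eq habc
  rw [rad_def, rad_def, hx, Nat.radical_eq_prod_primeFactors, Nat.radical_eq_prod_primeFactors]
  have ha0 : a ≠ 0 := ha.ne'; have hb0 : b ≠ 0 := hb.ne'; have hc0 : c ≠ 0 := hc.ne'
  have hΦ0 : Φ ≠ 0 := hΦ.ne'
  have hkey : (a * Φ * b ^ 5 * c ^ 5).primeFactors = (a * b * c).primeFactors ∪ Φ.primeFactors := by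
    rw [Nat.primeFactors_mul (by positivity) (by positivity),
      Nat.primeFactors_mul (by positivity) (by positivity),
      Nat.primeFactors_mul ha0 hΦ0, Nat.primeFactors_pow _ (by norm_num), Nat.primeFactors_pow _
        (by norm_num), Nat.primeFactors_mul (by positivity) hc0, Nat.primeFactors_mul ha0 hb0]
    ext p
    simp only [Finset.mem_union]
    tauto
  rw [hkey]
  calc (∏ p ∈ (a * b * c).primeFactors ∪ Φ.primeFactors, p)
      ≤ (∏ p ∈ (a * b * c).primeFactors, p) * ∏ p ∈ Φ.primeFactors, p :=
        prod_union_le_prod_mul_prod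
          (fun p hp => (Nat.prime_of_mem_primeFactors (Finset.mem_inter.mp hp).1).pos)
    _ ≤ (∏ p ∈ (a * b * c).primeFactors, p) * (5 * c ^ 4) := by
        apply Nat.mul_le_mul_left
        calc (∏ p ∈ Φ.primeFactors, p) = UniqueFactorizationMonoid.radical Φ :=
              (Nat.radical_eq_prod_primeFactors).symm
          _ ≤ Φ := Nat.radical_le_self_iff.mpr hΦ0
          _ ≤ 5 * c ^ 4 := quinticCofactor_le hbc

/-- **Breeding, depth**: `ω(b) + ω(c) ≤ ω₅((c⁵−b⁵)·b⁵·c⁵)`. [folklore] -/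
theorem card_primeFactors_le_depth_quinticBreed {a b c : ℕ} (h : IsABCTriple a b c) :
    b.primeFactors.card + c.primeFactors.card ≤
      (((c ^ 5 - b ^ 5) * b ^ 5 * c ^ 5).primeFactors.filter
        (fun p => 5 ≤ ((c ^ 5 - b ^ 5) * b ^ 5 * c ^ 5).factorization p)).card := by
  obtain ⟨ha, hb, habc, hcop⟩ := h
  have hc : 0 < c := by omega
  have hx : c ^ 5 - b ^ 5 = a * (c ^ 4 + c ^ 3 * b + c ^ 2 * b ^ 2 + c * b ^ 3 + b ^ 4) :=
    pow_five_sub_pow_five_eq habc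
  have hΦ0 : c ^ 4 + c ^ 3 * b + c ^ 2 * b ^ 2 + c * b ^ 3 + b ^ 4 ≠ 0 := (quinticCofactor_pos hc).ne'
  have ha0 : a ≠ 0 := ha.ne'; have hb0 : b ≠ 0 := hb.ne'; have hc0 : c ≠ 0 := hc.ne'
  have hx0 : c ^ 5 - b ^ 5 ≠ 0 := by rw [hx]; positivity
  have hcb : Nat.Coprime c b := by
    rw [← habc]; exact Nat.coprime_add_self_left.mpr hcop
  set P : ℕ := (c ^ 5 - b ^ 5) * b ^ 5 * c ^ 5 with hP
  have hP0 : P ≠ 0 := by positivity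
  have hfac : P.factorization =
      (c ^ 5 - b ^ 5).factorization + 5 • b.factorization + 5 • c.factorization := by
    rw [hP, Nat.factorization_mul (by positivity) (by positivity),
      Nat.factorization_mul hx0 (by positivity), Nat.factorization_pow, Nat.factorization_pow]
  rw [← Finset.card_union_of_disjoint (Nat.Coprime.disjoint_primeFactors hcb.symm)]
  apply Finset.card_le_card
  intro p hp
  rw [Finset.mem_filter]
  have hp' : p.Prime ∧ (p ∣ b ∨ p ∣ c) := by
    rcases Finset.mem_union.mp hp with h | h
    · exact ⟨Nat.prime_of_mem_primeFactors h, Or.inl (Nat.dvd_of_mem_primeFactors h)⟩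
    · exact ⟨Nat.prime_of_mem_primeFactors h, Or.inr (Nat.dvd_of_mem_primeFactors h)⟩
  obtain ⟨hpp, hdvd⟩ := hp'
  constructor
  · rw [Nat.mem_primeFactors]
    refine ⟨hpp, ?_, hP0⟩
    rcases hdvd with h | h
    · exact Dvd.dvd.mul_right (Dvd.dvd.mul_left (dvd_pow h (by norm_num)) _) _
    · exact Dvd.dvd.mul_left (dvd_pow h (by norm_num)) _
  · show 5 ≤ P.factorization p
    rw [hfac]
    simp only [Finsupp.add_apply, Finsupp.smul_apply, smul_eq_mul]
    rcases hdvd with h | h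
    · have : 1 ≤ b.factorization p := hpp.factorization_pos_of_dvd hb0 h
      omega
    · have : 1 ≤ c.factorization p := hpp.factorization_pos_of_dvd hc0 h
      omega

/-- `ω(abc) ≤ ω(a) + ω(b) + ω(c)`. [folklore] -/
theorem card_primeFactors_mul_three_le {a b c : ℕ} (ha : a ≠ 0) (hb : b ≠ 0) (hc : c ≠ 0) :
    (a * b * c).primeFactors.card ≤
      a.primeFactors.card + b.primeFactors.card + c.primeFactors.card := by
  rw [Nat.primeFactors_mul (by positivity) hc, Nat.primeFactors_mul ha hb]
  exact (Finset.card_union_le _ _).trans (Nat.add_le_add_right (Finset.card_union_le _ _) _)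

/-- From `c⁵ < C·(R·5c⁴)^(1+η)` with `0 < 1 − 4η` deduce
`c < (C·5^(1+η))^(1/(1−4η)) · R^((1+η)/(1−4η))`. [folklore] -/
theorem lt_of_quinticBreed_bound {C R c η : ℝ} (hC : 0 < C) (hR : 1 ≤ R) (hc : 1 ≤ c) (hη : 0 < η)
    (hη4 : 4 * η < 1)
    (h : c ^ (5 : ℕ) < C * (R * (5 * c ^ (4 : ℕ))) ^ (1 + η)) :
    c < (C * 5 ^ (1 + η)) ^ (1 / (1 - 4 * η)) * R ^ ((1 + η) * (1 / (1 - 4 * η))) := by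
  have hc0 : 0 < c := (by linarith); have hR0 : 0 < R := by linarith
  have ht : 0 < 1 - 4 * η := by linarith
  have ht' : 0 < 1 / (1 - 4 * η) := by positivity
  have hexp : (R * (5 * c ^ (4 : ℕ))) ^ (1 + η) = R ^ (1 + η) * 5 ^ (1 + η) * c ^ (4 * (1 + η)) := by
    rw [Real.mul_rpow hR0.le (by positivity), Real.mul_rpow (by norm_num) (by positivity)]
    rw [show (c ^ (4 : ℕ) : ℝ) = c ^ (4 : ℝ) by norm_cast, ← Real.rpow_mul hc0.le]
    ring
  rw [hexp] at h
  have hc5 : c ^ (5 : ℕ) = c ^ (5 : ℝ) := by norm_cast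
  rw [hc5] at h
  have hcpow : 0 < c ^ (4 * (1 + η)) := Real.rpow_pos_of_pos hc0 _
  have h2 : c ^ (5 : ℝ) / c ^ (4 * (1 + η)) < C * 5 ^ (1 + η) * R ^ (1 + η) := by
    rw [div_lt_iff₀ hcpow]
    calc c ^ (5 : ℝ) < C * (R ^ (1 + η) * 5 ^ (1 + η) * c ^ (4 * (1 + η))) := h
      _ = C * 5 ^ (1 + η) * R ^ (1 + η) * c ^ (4 * (1 + η)) := by ring
  rw [← Real.rpow_sub hc0] at h2
  have hsub : (5 : ℝ) - 4 * (1 + η) = 1 - 4 * η := by ring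
  rw [hsub] at h2
  have hlhs : 0 ≤ c ^ (1 - 4 * η) := (Real.rpow_pos_of_pos hc0 _).le
  have h3 := Real.rpow_lt_rpow hlhs h2 ht'
  rw [← Real.rpow_mul hc0.le, show (1 - 4 * η) * (1 / (1 - 4 * η)) = 1 by field_simp,
    Real.rpow_one] at h3
  calc c < (C * 5 ^ (1 + η) * R ^ (1 + η)) ^ (1 / (1 - 4 * η)) := h3
    _ = (C * 5 ^ (1 + η)) ^ (1 / (1 - 4 * η)) * R ^ ((1 + η) * (1 / (1 - 4 * η))) := by
        rw [Real.mul_rpow (by positivity) (by positivity), Real.rpow_mul hR0.le]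

/-- **The deep tail implies the many-primes tail** (`DeepRegimeABC`-statement ⟹ abc on `{ω(abc) ≥ W(ε)}`):
breed `(c⁵−b⁵) + b⁵ = c⁵` on the prime-richer of `{a, b}`. [folklore] -/
theorem omegaTail_of_deepRegime
    (h : ∀ ε : ℝ, 0 < ε → ∃ K : ℕ, ∃ C : ℝ, 0 < C ∧ ∀ a b c : ℕ, IsABCTriple a b c →
      K ≤ ((a * b * c).primeFactors.filter (fun p => 5 ≤ (a * b * c).factorization p)).card →
      (c : ℝ) < C * ((rad a b c : ℕ) : ℝ) ^ (1 + ε)) :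
    ∀ ε : ℝ, 0 < ε → ∃ W : ℕ, ∃ C : ℝ, 0 < C ∧ ∀ a b c : ℕ, IsABCTriple a b c →
      W ≤ (a * b * c).primeFactors.card → (c : ℝ) < C * ((rad a b c : ℕ) : ℝ) ^ (1 + ε) := by
  intro ε hε
  set η : ℝ := ε / (5 + 4 * ε) with hηdef
  have h54 : (0 : ℝ) < 5 + 4 * ε := by linarith
  have hη : 0 < η := by positivity
  have hη4 : 4 * η < 1 := by
    rw [hηdef, ← lt_div_iff₀' (by norm_num : (0:ℝ) < 4), div_lt_div_iff₀ h54 (by norm_num)]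
    linarith
  have hexp1 : (1 + η) * (1 / (1 - 4 * η)) = 1 + ε := by
    rw [hηdef]
    field_simp
    ring
  obtain ⟨K, C, hC, hK⟩ := h η hη
  set C' : ℝ := (C * 5 ^ (1 + η)) ^ (1 / (1 - 4 * η)) with hC'def
  have hC' : 0 < C' := Real.rpow_pos_of_pos (by positivity) _
  have core : ∀ a b c : ℕ, IsABCTriple a b c → K ≤ b.primeFactors.card + c.primeFactors.card →
      (c : ℝ) < C' * ((rad a b c : ℕ) : ℝ) ^ (1 + ε) := by
    intro a b c habc hKbc
    have habc' := isABCTriple_quinticBreed habc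
    have hdeep := hKbc.trans (card_primeFactors_le_depth_quinticBreed habc)
    have hlt := hK _ _ _ habc' hdeep
    obtain ⟨ha, hb, hsum, hcop⟩ := habc
    have hc1 : (1 : ℝ) ≤ c := by exact_mod_cast (show 1 ≤ c by omega)
    have hrad_pos : 0 < rad a b c := by
      rw [rad_def]
      exact Nat.pos_of_ne_zero UniqueFactorizationMonoid.radical_ne_zero
    have hR1 : (1 : ℝ) ≤ (rad a b c : ℕ) := by exact_mod_cast hrad_pos
    have hradle : ((rad (c ^ 5 - b ^ 5) (b ^ 5) (c ^ 5) : ℕ) : ℝ) ≤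
        (rad a b c : ℕ) * (5 * (c : ℝ) ^ (4 : ℕ)) := by
      exact_mod_cast rad_quinticBreed_le ⟨ha, hb, hsum, hcop⟩
    have h1η : 0 ≤ 1 + η := by linarith
    have hstep : (c : ℝ) ^ (5 : ℕ) <
        C * (((rad a b c : ℕ) : ℝ) * (5 * (c : ℝ) ^ (4 : ℕ))) ^ (1 + η) := by
      have hcast : ((c ^ 5 : ℕ) : ℝ) = (c : ℝ) ^ (5 : ℕ) := by push_cast; ring
      rw [← hcast]
      refine hlt.trans_le ?_
      apply mul_le_mul_of_nonneg_left _ hC.le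
      exact Real.rpow_le_rpow (Nat.cast_nonneg _) hradle h1η
    have := lt_of_quinticBreed_bound hC hR1 hc1 hη hη4 hstep
    rwa [hexp1] at this
  refine ⟨2 * K, C', hC', fun a b c habc hW => ?_⟩
  obtain ⟨ha, hb, hsum, hcop⟩ := habc
  have hω := card_primeFactors_mul_three_le ha.ne' hb.ne' (show c ≠ 0 by omega)
  by_cases hcase : a.primeFactors.card ≤ b.primeFactors.card
  · exact core a b c ⟨ha, hb, hsum, hcop⟩ (by omega)
  · have := core b a c (isABCTriple_swap ⟨ha, hb, hsum, hcop⟩) (by omega)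
    rwa [rad_swap] at this

/-! ## §5 The glue -/

/-- **BoundedOmegaABC ∧ OmegaTailABC ⟹ ABC** (option 3 of the c2 report with #6 in its ω-normal form):
case split at the single cell `W(ε)`, larger constant. [folklore] -/
theorem abc_of_boundedOmega_of_omegaTail
    (hB : ∀ W : ℕ, ∀ ε : ℝ, 0 < ε → ∃ C : ℝ, 0 < C ∧ ∀ a b c : ℕ, IsABCTriple a b c →
      (a * b * c).primeFactors.card ≤ W → (c : ℝ) < C * ((rad a b c : ℕ) : ℝ) ^ (1 + ε))
    (hT : ∀ ε : ℝ, 0 < ε → ∃ W : ℕ, ∃ C : ℝ, 0 < C ∧ ∀ a b c : ℕ, IsABCTriple a b c →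
      W ≤ (a * b * c).primeFactors.card → (c : ℝ) < C * ((rad a b c : ℕ) : ℝ) ^ (1 + ε)) :
    ABC := by
  rw [ABC_iff]
  intro ε hε
  obtain ⟨W, C₁, hC₁, hW⟩ := hT ε hε
  obtain ⟨C₂, _hC₂, hW'⟩ := hB W ε hε
  refine ⟨max C₁ C₂, lt_max_of_lt_left hC₁, fun a b c habc => ?_⟩
  have hr : (0 : ℝ) ≤ ((rad a b c : ℕ) : ℝ) ^ (1 + ε) := Real.rpow_nonneg (Nat.cast_nonneg _) _
  by_cases hK : W ≤ (a * b * c).primeFactors.card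
  · exact (hW a b c habc hK).trans_le (mul_le_mul_of_nonneg_right (le_max_left _ _) hr)
  · exact (hW' a b c habc (not_le.mp hK).le).trans_le
      (mul_le_mul_of_nonneg_right (le_max_right _ _) hr)

/-- **BoundedOmegaABC ∧ DeepRegimeABC ⟹ ABC** (option 3 with #6 as filed): through `omegaTail_of_deepRegime`.
[folklore] -/
theorem abc_of_boundedOmega_of_deepRegime
    (hB : ∀ W : ℕ, ∀ ε : ℝ, 0 < ε → ∃ C : ℝ, 0 < C ∧ ∀ a b c : ℕ, IsABCTriple a b c →
      (a * b * c).primeFactors.card ≤ W → (c : ℝ) < C * ((rad a b c : ℕ) : ℝ) ^ (1 + ε))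
    (h₆ : ∀ ε : ℝ, 0 < ε → ∃ K : ℕ, ∃ C : ℝ, 0 < C ∧ ∀ a b c : ℕ, IsABCTriple a b c →
      K ≤ ((a * b * c).primeFactors.filter (fun p => 5 ≤ (a * b * c).factorization p)).card →
      (c : ℝ) < C * ((rad a b c : ℕ) : ℝ) ^ (1 + ε)) :
    ABC :=
  abc_of_boundedOmega_of_omegaTail hB (omegaTail_of_deepRegime h₆)

/-- **HEAVY-CORE ∧ DeepRegimeABC ⟹ ABC** (option 2 of the c2 report: #2 restated as its heavy child
`HeavyPlacesFour`, #6 as filed): `boundedOmega_of_heavyCore` then `abc_of_boundedOmega_of_deepRegime`. [folklore] -/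
theorem abc_of_heavyCore_of_deepRegime
    (h₂ : ∀ θ : ℝ, 0 < θ → θ ≤ 1 → ∀ ε : ℝ, 0 < ε → ∃ C : ℝ, 0 < C ∧ ∀ S : Finset ℕ, S.Nonempty →
      (∀ p ∈ S, Nat.Prime p) → ∀ a b c : ℕ, IsABCTriple a b c →
      (∀ p ∈ S, (c : ℝ) ^ θ ≤ ((p ^ (a * b * c).factorization p : ℕ) : ℝ)) →
      (c : ℝ) < C * ((((∏ p ∈ S, p) *
        ∏ p ∈ (a * b * c).primeFactors \ S, p ^ (((a * b * c).factorization p + 3) / 4) : ℕ) : ℝ)) ^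
          (1 + ε))
    (h₆ : ∀ ε : ℝ, 0 < ε → ∃ K : ℕ, ∃ C : ℝ, 0 < C ∧ ∀ a b c : ℕ, IsABCTriple a b c →
      K ≤ ((a * b * c).primeFactors.filter (fun p => 5 ≤ (a * b * c).factorization p)).card →
      (c : ℝ) < C * ((rad a b c : ℕ) : ℝ) ^ (1 + ε)) :
    ABC :=
  abc_of_boundedOmega_of_deepRegime (boundedOmega_of_heavyCore h₂) h₆

end Summit.ABC.ABC.Theses.IneffectiveSubspace.ClosesGlueC2

end
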